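import Mathlib
import Literature.Computability.AlgebraicComplexity.PrattTrapezoidValSTPP

/-!
# Cyclic reduction, transfer step: SDPP pairs move into a prime cyclic host (support file)

Item `stmt-MatrixMultiplication-14313` (`FourierTwoFamiliesModP.CyclicReduction`, Umans' cyclic
reduction as recorded in Pratt, arXiv:2309.03878, p. 10).  This file is the carry-free lift:

* `sdpp_direct_image_of_reflect₂`, `sdpp_cross_image_of_reflect₂`, `injective_of_reflect₂` — the two
  clauses (W) (each pair `Aᵢ ⊕ Bᵢ` direct) and (X) (`(a - a') + (b - b') = 0`, `a ∈ Aᵢ, a' ∈ Aⱼ,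
  b ∈ Bⱼ, b' ∈ B_k ⟹ i = k`) of the simultaneous double product property are preserved under ANY
  map `φ : H → K` of abelian groups reflecting two-fold sums (`φ a + φ b = φ a' + φ b' → a + b = a' + b'`),
  and such a map is injective (sizes are preserved);
* `exists_prime_sdpp_of_addEquiv` — for `H ≃ ∏_{j<k} ℤ/m_j` the tree's mixed-radix map
  `ψ : H → ℕ` (`exists_freiman3_of_addEquiv`, three-fold sums `< 3^k ∏ m_j`) composed with
  `ℕ → ℤ/p` for a Bertrand prime `p ∈ (3^k ∏ m_j, 2 · 3^k ∏ m_j]` reflects two-fold sums, so the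
  images of SDPP pairs are SDPP pairs of the same sizes in `ℤ/pℤ`, `p ≤ 2 · 3^k · |H|`.

The counting of the cyclic factors `k` (slice rank) is in the main file
`FourierTwoFamiliesModPCyclicReduction.lean`.
-/

-- single-conjunct summit: the mandated namespace `Summit.MatrixMultiplication.MatrixMultiplication.…`
-- repeats `MatrixMultiplication` (summit = sub-problem), which `linter.dupNamespace` would flag.
set_option linter.dupNamespace false

namespace Summit.MatrixMultiplication.MatrixMultiplication.Theorems

open Finset Literature.Computability.AlgebraicComplexity

section Transfer

variable {H K : Type*} [AddCommGroup H] [AddCommGroup K] [DecidableEq K] {n : ℕ}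
  {A B : Fin n → Finset H}

omit [DecidableEq K] in
/-- A map of abelian groups reflecting two-fold sums is injective. -/
theorem injective_of_reflect₂ (φ : H → K)
    (hφ : ∀ a b a' b', φ a + φ b = φ a' + φ b' → a + b = a' + b') : Function.Injective φ := by
  intro a a' h
  have h2 : a + a = a' + a := hφ a a a' a (by rw [h])
  exact add_right_cancel h2

/-- Clause (W) of the SDPP (each pair has the double product property,
`(a - a') + (b - b') = 0 ⟹ a = a' ∧ b = b'` inside a pair) is preserved by taking images under a
map reflecting two-fold sums. -/
theorem sdpp_direct_image_of_reflect₂ (φ : H → K)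
    (hφ : ∀ a b a' b', φ a + φ b = φ a' + φ b' → a + b = a' + b')
    (hW : ∀ i : Fin n, ∀ a ∈ A i, ∀ a' ∈ A i, ∀ b ∈ B i, ∀ b' ∈ B i,
      (a - a') + (b - b') = 0 → a = a' ∧ b = b') :
    ∀ i : Fin n, ∀ a ∈ (A i).image φ, ∀ a' ∈ (A i).image φ, ∀ b ∈ (B i).image φ,
      ∀ b' ∈ (B i).image φ, (a - a') + (b - b') = 0 → a = a' ∧ b = b' := by
  intro i x hx x' hx' y hy y' hy' he
  obtain ⟨a, ha, rfl⟩ := mem_image.1 hx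
  obtain ⟨a', ha', rfl⟩ := mem_image.1 hx'
  obtain ⟨b, hb, rfl⟩ := mem_image.1 hy
  obtain ⟨b', hb', rfl⟩ := mem_image.1 hy'
  have h2 : φ a + φ b = φ a' + φ b' := by
    rw [← sub_eq_zero, ← he]; abel
  have h3 := hφ _ _ _ _ h2
  obtain ⟨rfl, rfl⟩ := hW i a ha a' ha' b hb b' hb'
    (by rw [← sub_eq_zero] at h3; rw [← h3]; abel)
  exact ⟨rfl, rfl⟩

/-- Clause (X) of the SDPP (`(a - a') + (b - b') = 0` with `a ∈ Aᵢ, a' ∈ Aⱼ, b ∈ Bⱼ, b' ∈ B_k`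
forces `i = k`) is preserved by taking images under a map reflecting two-fold sums. -/
theorem sdpp_cross_image_of_reflect₂ (φ : H → K)
    (hφ : ∀ a b a' b', φ a + φ b = φ a' + φ b' → a + b = a' + b')
    (hX : ∀ i j k : Fin n, ∀ a ∈ A i, ∀ a' ∈ A j, ∀ b ∈ B j, ∀ b' ∈ B k,
      (a - a') + (b - b') = 0 → i = k) :
    ∀ i j k : Fin n, ∀ a ∈ (A i).image φ, ∀ a' ∈ (A j).image φ, ∀ b ∈ (B j).image φ,
      ∀ b' ∈ (B k).image φ, (a - a') + (b - b') = 0 → i = k := by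
  intro i j k x hx x' hx' y hy y' hy' he
  obtain ⟨a, ha, rfl⟩ := mem_image.1 hx
  obtain ⟨a', ha', rfl⟩ := mem_image.1 hx'
  obtain ⟨b, hb, rfl⟩ := mem_image.1 hy
  obtain ⟨b', hb', rfl⟩ := mem_image.1 hy'
  have h2 : φ a + φ b = φ a' + φ b' := by
    rw [← sub_eq_zero, ← he]; abel
  have h3 := hφ _ _ _ _ h2
  exact hX i j k a ha a' ha' b hb b' hb' (by rw [← sub_eq_zero] at h3; rw [← h3]; abel)

end Transfer

section PrimeHost

/-- **The carry-free lift into a prime cyclic group** (Umans' cyclic reduction, Pratt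
arXiv:2309.03878 p. 10, transfer step): if `H ≃ ∏_{j<k} ℤ/m_j` (`m_j > 0`) carries SDPP pairs
`(Aᵢ, Bᵢ)_{i<n}`, then some prime `p ≤ 2 · 3^k · ∏ m_j` carries SDPP pairs `(A'ᵢ, B'ᵢ)_{i<n}` in
`ℤ/pℤ` with `|A'ᵢ| = |Aᵢ|`, `|B'ᵢ| = |Bᵢ|`: the images under `x ↦ ψ x mod p`, `ψ` the mixed-radix map
of the tree (`exists_freiman3_of_addEquiv`, three-fold sums `< 3^k ∏ m_j < p`), which reflects
two-fold sums. -/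
theorem exists_prime_sdpp_of_addEquiv {H : Type*} [AddCommGroup H] {n : ℕ}
    {A B : Fin n → Finset H}
    (hW : ∀ i : Fin n, ∀ a ∈ A i, ∀ a' ∈ A i, ∀ b ∈ B i, ∀ b' ∈ B i,
      (a - a') + (b - b') = 0 → a = a' ∧ b = b')
    (hX : ∀ i j k : Fin n, ∀ a ∈ A i, ∀ a' ∈ A j, ∀ b ∈ B j, ∀ b' ∈ B k,
      (a - a') + (b - b') = 0 → i = k)
    {k : ℕ} {m : Fin k → ℕ} (hm : ∀ j, 0 < m j) (e : H ≃+ Π j, ZMod (m j)) :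
    ∃ p : ℕ, p.Prime ∧ p ≤ 2 * (3 ^ k * ∏ j, m j) ∧
      ∃ A' B' : Fin n → Finset (ZMod p),
        (∀ i, (A' i).card = (A i).card ∧ (B' i).card = (B i).card) ∧
        (∀ i : Fin n, ∀ a ∈ A' i, ∀ a' ∈ A' i, ∀ b ∈ B' i, ∀ b' ∈ B' i,
          (a - a') + (b - b') = 0 → a = a' ∧ b = b') ∧
        (∀ i j k : Fin n, ∀ a ∈ A' i, ∀ a' ∈ A' j, ∀ b ∈ B' j, ∀ b' ∈ B' k,
          (a - a') + (b - b') = 0 → i = k) := by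
  classical
  obtain ⟨ψ, h1, h2⟩ := exists_freiman3_of_addEquiv hm e
  set R : ℕ := 3 ^ k * ∏ j, m j with hR
  have hR0 : R ≠ 0 := by have := h1 0 0 0; omega
  obtain ⟨p, hp, hRp, hp2R⟩ := Nat.exists_prime_lt_and_le_two_mul R hR0
  haveI : Fact p.Prime := ⟨hp⟩
  set φ : H → ZMod p := fun x => ((ψ x : ℕ) : ZMod p) with hφ
  have h2sum : ∀ a b, ψ a + ψ b < p := fun a b => by have := h1 a b 0; omega
  have hφr : ∀ a b a' b', φ a + φ b = φ a' + φ b' → a + b = a' + b' := by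
    intro a b a' b' h
    have h' : ((ψ a + ψ b : ℕ) : ZMod p) = ((ψ a' + ψ b' : ℕ) : ZMod p) := by
      push_cast; exact h
    rw [ZMod.natCast_eq_natCast_iff', Nat.mod_eq_of_lt (h2sum _ _),
      Nat.mod_eq_of_lt (h2sum _ _)] at h'
    have h3 := h2 a b 0 a' b' 0 (by rw [h'])
    simpa only [add_zero] using h3
  have hinj := injective_of_reflect₂ φ hφr
  exact ⟨p, hp, hp2R, fun i => (A i).image φ, fun i => (B i).image φ,
    fun i => ⟨card_image_of_injective _ hinj, card_image_of_injective _ hinj⟩,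
    sdpp_direct_image_of_reflect₂ φ hφr hW, sdpp_cross_image_of_reflect₂ φ hφr hX⟩

end PrimeHost

end Summit.MatrixMultiplication.MatrixMultiplication.Theorems
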